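import Summits.Ventures.GridStability.Models.LossyNumericalRangeSwing
import Summits.Ventures.GridStability.Models.InverterNetworkVoltageLinearisation

/-!
# GridStability/Models/DroopQVDeflation — the POINT lane of rung G3.b WITHOUT coordinate reduction, any `n`: Brauer deflation of the rotation mode of the droop+QV Jacobian

Cell `gridfusion` (LADDER-GRIDFUSION, APEX LINE rung G3.b; seat gridfusion-model-8 (g0); infrastructure for the point-lane RATE rows
(#51 «G3.b-ss-DROOPQV-WSCC9-POINT», #81 «…-LOSSY-POINT») at larger `n`). The instance files so far quotient the rotation mode by
hand (`J₈` on `(θ₁ − θ₀, θ₂ − θ₀, ω, V)` with an emitted `eig_reduce` whose size grows like `3n`). Model-3's Brauer lever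
(`Models/LossyNumericalRangeSwing.lean` §0, `exists_eig_deflate` for a matrix with zero ROW sums and the all-ones vector) is here
generalised to an ARBITRARY kernel vector — the droop+QV Jacobian kills `r = [1; 0; 0]`, not `1`:
* §1 `exists_eig_deflate_of_mulVec_eq_zero` ([folklore], Brauer): `A r = 0`, `ζ` real, `γ = ζᵀr`; an eigenpair `A x = μ x`, `x ≠ 0`,
  `μ ≠ 0`, `μ ≠ γ` gives an eigenpair of the DEFLATED matrix `A + r ζᵀ` for the same `μ` (eigenvector `x + (ζᵀx/(μ − γ))·r`);
  `mem_span_of_mulVec_eq_zero_of_deflate`: if moreover `γ ≠ 0` and `A + r ζᵀ` has no eigenvalue `0` (e.g. by a point certificate)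
  then `A x = 0` forces `x ∈ ℂ·r`;
* §2 `DroopMicrogrid.eig_re_lt_neg_of_deflate` — **the reduction-free point lane**: for ANY `n` and any instance, with data `ζ` such
  that `γ = Σ_{θ-indices} ζ < −r₀` (so `γ ≠ 0`), `S ≻ 0` and `S(−J') + (S(−J'))ᵀ − 2r₀·S ≻ 0` for `J' = jacMatrix (θ, V) + r ζᵀ`
  (`r₀ > 0`), EVERY complex eigenpair `(z, v)` of `jacMatrix (θ, V)` is the rotation mode (`z = 0`, `v ∈ ℂ·r`) or has `Re z < −r₀`.
  One `3n × 3n` certificate pair on the deflated matrix (flattened to `Fin 3n` in instance files), no `eig_reduce`.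
THREE COLUMNS. CERTIFIED (kernel): linear algebra + a theorem about the MATRIX `jacMatrix` of model N1 (MV-6N); per-instance input = the
two PSD facts. No parameter values, no instance; no sentence of this file says a converter or a microgrid is stable.
-/

noncomputable section

open Real Matrix Finset
open scoped ComplexOrder

namespace Summit.Ventures.GridStability.Models

/-! ## §1 Brauer deflation along an arbitrary kernel vector -/

section Deflate

variable {ι : Type*} [Fintype ι] [DecidableEq ι]

omit [DecidableEq ι] in
/-- **Brauer deflation along a kernel vector.** `A` real with `A r = 0`, `ζ` real, `γ = Σ_j ζ_j r_j`: an eigenpair `A x = μ x`,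
`x ≠ 0`, with `μ ≠ 0` and `μ ≠ γ` gives an eigenpair of `A + r ζᵀ` for the same `μ`, with eigenvector `x + α·r`,
`α = ζᵀx/(μ − γ)`. [folklore] -/
theorem exists_eig_deflate_of_mulVec_eq_zero {A : Matrix ι ι ℝ} {r : ι → ℝ} (hr : A *ᵥ r = 0) (ζ : ι → ℝ) {μ : ℂ}
    {x : ι → ℂ} (hx : x ≠ 0) (hAx : A.map ((↑) : ℝ → ℂ) *ᵥ x = μ • x) (hμ0 : μ ≠ 0)
    (hμγ : μ ≠ ((∑ j, ζ j * r j : ℝ) : ℂ)) :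
    ∃ x' : ι → ℂ, x' ≠ 0 ∧
      (A + Matrix.vecMulVec r ζ).map ((↑) : ℝ → ℂ) *ᵥ x' = μ • x' := by
  set γ : ℂ := ((∑ j, ζ j * r j : ℝ) : ℂ) with hγdef
  set t : ℂ := ∑ j, (ζ j : ℂ) * x j with htdef
  have hμγ' : μ - γ ≠ 0 := sub_ne_zero.2 hμγ
  set α : ℂ := t / (μ - γ) with hαdef
  have hAr : A.map ((↑) : ℝ → ℂ) *ᵥ (fun j => (r j : ℂ)) = 0 := by
    funext i
    rw [map_ofReal_mulVec_apply]
    have h := congr_fun hr i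
    simp only [Matrix.mulVec, dotProduct, Pi.zero_apply] at h
    have : (∑ j, (A i j : ℂ) * (r j : ℂ)) = ((∑ j, A i j * r j : ℝ) : ℂ) := by push_cast; rfl
    rw [this, h]; simp
  refine ⟨fun i => x i + α * (r i : ℂ), ?_, ?_⟩
  · intro h0
    have hxc : x = fun i => -(α * (r i : ℂ)) := by
      funext i
      have := congr_fun h0 i
      simp only [Pi.zero_apply] at this
      linear_combination this
    have hA0 : A.map ((↑) : ℝ → ℂ) *ᵥ x = 0 := by
      have : x = (-α) • fun j => (r j : ℂ) := by
        rw [hxc]; funext i; simp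
      rw [this, Matrix.mulVec_smul, hAr, smul_zero]
    rw [hA0] at hAx
    rcases smul_eq_zero.1 hAx.symm with h | h
    · exact hμ0 h
    · exact hx h
  · have hAxi : ∀ i, (∑ j, (A i j : ℂ) * x j) = μ * x i := fun i => by
      have := congr_fun hAx i
      rwa [map_ofReal_mulVec_apply] at this
    have hAri : ∀ i, (∑ j, (A i j : ℂ) * (r j : ℂ)) = 0 := fun i => by
      have := congr_fun hAr i
      rwa [map_ofReal_mulVec_apply] at this
    have hγsum : (∑ j, (ζ j : ℂ) * (r j : ℂ)) = γ := by rw [hγdef]; push_cast; rfl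
    have hkey : t + α * γ = μ * α := by
      rw [hαdef]; field_simp; ring
    funext i
    rw [map_ofReal_mulVec_apply]
    simp only [Matrix.add_apply, Matrix.vecMulVec_apply, Pi.smul_apply, smul_eq_mul]
    push_cast
    have h1 : ∑ j, ((A i j : ℂ) + (r i : ℂ) * (ζ j : ℂ)) * (x j + α * (r j : ℂ))
        = (∑ j, (A i j : ℂ) * x j) + α * (∑ j, (A i j : ℂ) * (r j : ℂ)) + (r i : ℂ) * t
          + (r i : ℂ) * α * ∑ j, (ζ j : ℂ) * (r j : ℂ) := by
      rw [htdef, Finset.mul_sum, Finset.mul_sum, Finset.mul_sum, ← Finset.sum_add_distrib, ← Finset.sum_add_distrib,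
        ← Finset.sum_add_distrib]
      refine Finset.sum_congr rfl fun j _ => ?_
      ring
    rw [h1, hAxi i, hAri i, hγsum, mul_zero, add_zero]
    linear_combination (r i : ℂ) * hkey

omit [DecidableEq ι] in
/-- **Kernel along the deflation.** `A r = 0`, `γ = Σ ζ_j r_j ≠ 0`, and the deflated matrix `A + r ζᵀ` has no eigenvalue `0`
(no nonzero complex `w` with `(A + r ζᵀ) w = 0`): then `A x = 0` forces `x = (ζᵀx/γ)·r`. [folklore] -/
theorem eq_smul_of_mulVec_eq_zero_of_deflate {A : Matrix ι ι ℝ} {r : ι → ℝ} (hr : A *ᵥ r = 0) {ζ : ι → ℝ}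
    (hγ : ∑ j, ζ j * r j ≠ 0)
    (hinj : ∀ w : ι → ℂ, (A + Matrix.vecMulVec r ζ).map ((↑) : ℝ → ℂ) *ᵥ w = 0 → w = 0)
    {x : ι → ℂ} (hAx : A.map ((↑) : ℝ → ℂ) *ᵥ x = 0) :
    x = fun i => ((∑ j, (ζ j : ℂ) * x j) / ((∑ j, ζ j * r j : ℝ) : ℂ)) * (r i : ℂ) := by
  set γ : ℂ := ((∑ j, ζ j * r j : ℝ) : ℂ) with hγdef
  have hγ0 : γ ≠ 0 := by rw [hγdef]; exact_mod_cast hγ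
  set t : ℂ := ∑ j, (ζ j : ℂ) * x j with htdef
  have hAr : ∀ i, (∑ j, (A i j : ℂ) * (r j : ℂ)) = 0 := fun i => by
    have h := congr_fun hr i
    simp only [Matrix.mulVec, dotProduct, Pi.zero_apply] at h
    have : (∑ j, (A i j : ℂ) * (r j : ℂ)) = ((∑ j, A i j * r j : ℝ) : ℂ) := by push_cast; rfl
    rw [this, h]; simp
  have hAxi : ∀ i, (∑ j, (A i j : ℂ) * x j) = 0 := fun i => by
    have := congr_fun hAx i
    rwa [map_ofReal_mulVec_apply] at this
  have hγsum : (∑ j, (ζ j : ℂ) * (r j : ℂ)) = γ := by rw [hγdef]; push_cast; rfl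
  -- (A + rζᵀ)(x − (t/γ) r) = r t − (t/γ)·γ·r = 0
  have h0 : (A + Matrix.vecMulVec r ζ).map ((↑) : ℝ → ℂ) *ᵥ (fun i => x i - (t / γ) * (r i : ℂ)) = 0 := by
    funext i
    rw [map_ofReal_mulVec_apply]
    simp only [Matrix.add_apply, Matrix.vecMulVec_apply, Pi.zero_apply]
    push_cast
    have h1 : ∑ j, ((A i j : ℂ) + (r i : ℂ) * (ζ j : ℂ)) * (x j - t / γ * (r j : ℂ))
        = (∑ j, (A i j : ℂ) * x j) - (t / γ) * (∑ j, (A i j : ℂ) * (r j : ℂ)) + (r i : ℂ) * ∑ j, (ζ j : ℂ) * x j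
          - (r i : ℂ) * (t / γ) * ∑ j, (ζ j : ℂ) * (r j : ℂ) := by
      rw [Finset.mul_sum, Finset.mul_sum, Finset.mul_sum, ← Finset.sum_sub_distrib, ← Finset.sum_add_distrib,
        ← Finset.sum_sub_distrib]
      refine Finset.sum_congr rfl fun j _ => ?_
      ring
    rw [h1, hAxi i, hAr i, hγsum, ← htdef]
    field_simp
    ring
  have h := hinj _ h0
  funext i
  have hi := congr_fun h i
  simp only [Pi.zero_apply, sub_eq_zero] at hi
  rw [hi]

end Deflate

/-! ## §2 The reduction-free point lane for the droop microgrid with voltage dynamics -/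

namespace DroopMicrogrid

variable {n : ℕ} (mg : DroopMicrogrid n)

/-- The rotation vector `r = [1; 0; 0]` on the state index. [folklore] -/
def rot : Fin n ⊕ (Fin n ⊕ Fin n) → ℝ := Sum.elim (fun _ => (1 : ℝ)) (Sum.elim 0 0)

/-- `jacMatrix (θ, V) r = 0`. [folklore] -/
theorem jacMatrix_mulVec_rot (θ V : Fin n → ℝ) : mg.jacMatrix θ V *ᵥ rot = 0 :=
  mg.jacMatrix_mulVec_rotation θ V

/-- The DEFLATED Jacobian `J' = jacMatrix (θ, V) + r ζᵀ` (Brauer shift of the rotation mode to `γ = Σ_k ζ_k r_k`; `ζ` is certificate data).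
[folklore] -/
def jacDefl (θ V : Fin n → ℝ) (ζ : Fin n ⊕ (Fin n ⊕ Fin n) → ℝ) : Matrix (Fin n ⊕ (Fin n ⊕ Fin n)) (Fin n ⊕ (Fin n ⊕ Fin n)) ℝ :=
  mg.jacMatrix θ V + Matrix.vecMulVec rot ζ

/-- **The reduction-free POINT lane (any `n`).** Data `ζ` with `γ = Σ_k ζ_k r_k < −r₀`, `r₀ > 0`; certificates `S ≻ 0` and
`S·(−J') + (S·(−J'))ᵀ − 2r₀·S ≻ 0` for the deflated Jacobian `J' = jacMatrix (θ, V) + r ζᵀ`. Then every complex eigenpair `(z, v)` of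
`jacMatrix (θ, V)` is the ROTATION MODE (`z = 0` and `v ∈ ℂ·r`) or has `Re z < −r₀`. CERTIFIED (matrix statement about the MODEL N1,
MV-6N); no instance; no stability sentence. [folklore] -/
theorem eig_re_lt_neg_of_deflate (θ V : Fin n → ℝ) (ζ : Fin n ⊕ (Fin n ⊕ Fin n) → ℝ) {r₀ : ℝ} (hr₀ : 0 < r₀)
    (hγ : ∑ k, ζ k * rot k < -r₀) {S : Matrix (Fin n ⊕ (Fin n ⊕ Fin n)) (Fin n ⊕ (Fin n ⊕ Fin n)) ℝ} (hS : S.PosDef)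
    (hH : (S * (-mg.jacDefl θ V ζ) + (S * (-mg.jacDefl θ V ζ))ᵀ - (2 * r₀) • S).PosDef)
    {z : ℂ} {v : Fin n ⊕ (Fin n ⊕ Fin n) → ℂ} (hv : v ≠ 0)
    (hJv : (mg.jacMatrix θ V).map ((↑) : ℝ → ℂ) *ᵥ v = z • v) :
    (z = 0 ∧ ∃ a : ℂ, v = fun k => a * (rot k : ℂ)) ∨ z.re < -r₀ := by
  classical
  have hγne : ∑ k, ζ k * rot k ≠ 0 := by
    intro h; rw [h] at hγ; linarith
  -- the deflated matrix has no eigenvalue with Re ≥ −r₀; in particular it is injective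
  have hdefl : ∀ {μ : ℂ} {w : Fin n ⊕ (Fin n ⊕ Fin n) → ℂ}, w ≠ 0 →
      (mg.jacDefl θ V ζ).map ((↑) : ℝ → ℂ) *ᵥ w = μ • w → μ.re < -r₀ := by
    intro μ w hw hJw
    have hneg : (-mg.jacDefl θ V ζ).map ((↑) : ℝ → ℂ) *ᵥ w = (-μ) • w := by
      rw [Matrix.map_neg _ (fun a => Complex.ofReal_neg a), Matrix.neg_mulVec, hJw, neg_smul]
    have h := re_eig_gt_of_numRange_shift hS hH hw hneg
    simp at h
    linarith
  by_cases hz0 : z = 0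
  · left
    refine ⟨hz0, ?_⟩
    subst hz0
    rw [zero_smul] at hJv
    have hinj : ∀ w : Fin n ⊕ (Fin n ⊕ Fin n) → ℂ,
        (mg.jacMatrix θ V + Matrix.vecMulVec rot ζ).map ((↑) : ℝ → ℂ) *ᵥ w = 0 → w = 0 := by
      intro w hw
      by_contra hne
      have h := hdefl (μ := 0) hne (by rw [jacDefl, hw, zero_smul])
      simp at h
      linarith
    refine ⟨(∑ j, (ζ j : ℂ) * v j) / ((∑ j, ζ j * rot j : ℝ) : ℂ), ?_⟩
    exact eq_smul_of_mulVec_eq_zero_of_deflate (mg.jacMatrix_mulVec_rot θ V) hγne hinj hJv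
  · right
    by_cases hzγ : z = ((∑ j, ζ j * rot j : ℝ) : ℂ)
    · rw [hzγ]; simpa using hγ
    · obtain ⟨x', hx', hJx'⟩ := exists_eig_deflate_of_mulVec_eq_zero (mg.jacMatrix_mulVec_rot θ V) ζ hv hJv hz0 hzγ
      exact hdefl hx' (by rw [jacDefl]; exact hJx')

/-- `jacMatrix (θ, V)` kills the rotation vector over `ℂ`. [folklore] -/
theorem jacMatrix_map_mulVec_rot (θ V : Fin n → ℝ) :
    (mg.jacMatrix θ V).map ((↑) : ℝ → ℂ) *ᵥ (fun k => ((rot k : ℝ) : ℂ)) = 0 := by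
  have h := mg.jacMatrix_mulVec_rot θ V
  funext k
  rw [map_ofReal_mulVec_apply]
  have hk := congr_fun h k
  simp only [Matrix.mulVec, dotProduct, Pi.zero_apply] at hk
  have : (∑ j, ((mg.jacMatrix θ V k j : ℝ) : ℂ) * ((rot j : ℝ) : ℂ)) = ((∑ j, mg.jacMatrix θ V k j * rot j : ℝ) : ℂ) := by
    push_cast; rfl
  rw [this, hk]; simp

/-- **No Jordan chain at the rotation zero (deflation lane, any `n`; lead g6 RULING 7c / ref-3 12:22:29Z).** Under the hypotheses of
`eig_re_lt_neg_of_deflate` (data `ζ` with `γ = Σ ζ_k r_k < −r₀ < 0`; `S ≻ 0`, `S(−J') + (S(−J'))ᵀ − 2r₀S ≻ 0` for the deflated `J' = J + r ζᵀ`)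
NO complex `w` solves `J w = r`: otherwise `J' w = (1 + ζᵀw)·r`, `J' r = γ·r`, and `w − ((1 + ζᵀw)/γ)·r` would be an eigenvector of `J'` at `0`
(it is nonzero, else `J w = 0 ≠ r`), contradicting the certificate. With `ker J = ℂ·r` (`eig_re_lt_neg_of_deflate`) this makes the eigenvalue `0`
ALGEBRAICALLY SIMPLE (`ker J² = ker J`). CERTIFIED (matrix statement, MV-6N); no instance. [folklore] -/
theorem no_jordan_chain_at_zero_of_deflate (θ V : Fin n → ℝ) (ζ : Fin n ⊕ (Fin n ⊕ Fin n) → ℝ) {r₀ : ℝ} (hr₀ : 0 < r₀)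
    (hγ : ∑ k, ζ k * rot k < -r₀) {S : Matrix (Fin n ⊕ (Fin n ⊕ Fin n)) (Fin n ⊕ (Fin n ⊕ Fin n)) ℝ} (hS : S.PosDef)
    (hH : (S * (-mg.jacDefl θ V ζ) + (S * (-mg.jacDefl θ V ζ))ᵀ - (2 * r₀) • S).PosDef)
    {w : Fin n ⊕ (Fin n ⊕ Fin n) → ℂ}
    (hw : (mg.jacMatrix θ V).map ((↑) : ℝ → ℂ) *ᵥ w = fun k => ((rot k : ℝ) : ℂ)) : False := by
  classical
  set rC : Fin n ⊕ (Fin n ⊕ Fin n) → ℂ := fun k => ((rot k : ℝ) : ℂ) with hrC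
  set γ : ℂ := ((∑ k, ζ k * rot k : ℝ) : ℂ) with hγdef
  have hγ0 : γ ≠ 0 := by
    rw [hγdef]
    have : ∑ k, ζ k * rot k ≠ 0 := by intro h; rw [h] at hγ; linarith
    exact_mod_cast this
  set t : ℂ := ∑ k, (ζ k : ℂ) * w k with htdef
  -- the deflated matrix on w and on r
  have hdef : ∀ y : Fin n ⊕ (Fin n ⊕ Fin n) → ℂ, (mg.jacDefl θ V ζ).map ((↑) : ℝ → ℂ) *ᵥ y
      = (mg.jacMatrix θ V).map ((↑) : ℝ → ℂ) *ᵥ y + (∑ k, (ζ k : ℂ) * y k) • rC := by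
    intro y
    rw [jacDefl, Matrix.map_add _ (fun a b => Complex.ofReal_add a b), Matrix.add_mulVec]
    congr 1
    funext k
    simp only [map_ofReal_mulVec_apply, Matrix.vecMulVec_apply, Pi.smul_apply, smul_eq_mul, hrC, Finset.sum_mul]
    push_cast
    exact Finset.sum_congr rfl fun j _ => by ring
  have hγsum : (∑ k, (ζ k : ℂ) * rC k) = γ := by rw [hγdef, hrC]; push_cast; rfl
  have hJr : (mg.jacDefl θ V ζ).map ((↑) : ℝ → ℂ) *ᵥ rC = γ • rC := by
    rw [hdef, jacMatrix_map_mulVec_rot, zero_add, hγsum]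
  have hJw : (mg.jacDefl θ V ζ).map ((↑) : ℝ → ℂ) *ᵥ w = (1 + t) • rC := by
    rw [hdef, hw, add_smul, one_smul]
  set w' : Fin n ⊕ (Fin n ⊕ Fin n) → ℂ := w - ((1 + t) / γ) • rC with hw'def
  have hJw' : (mg.jacDefl θ V ζ).map ((↑) : ℝ → ℂ) *ᵥ w' = (0 : ℂ) • w' := by
    rw [zero_smul, hw'def, Matrix.mulVec_sub, Matrix.mulVec_smul, hJw, hJr, smul_smul]
    have : (1 + t) / γ * γ = 1 + t := by field_simp
    rw [this, sub_self]
  by_cases hw'0 : w' = 0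
  · -- then w ∈ ℂ·r, so J w = 0, contradicting J w = r ≠ 0
    have hwr : w = ((1 + t) / γ) • rC := by
      have := hw'0; rw [hw'def, sub_eq_zero] at this; exact this
    have hJ0 : (mg.jacMatrix θ V).map ((↑) : ℝ → ℂ) *ᵥ w = 0 := by
      rw [hwr, Matrix.mulVec_smul, jacMatrix_map_mulVec_rot, smul_zero]
    rw [hJ0] at hw
    -- rC = 0 forces the sum Σ ζ_k r_k = 0
    have hr0 : ∀ k, rot k = 0 := fun k => by
      have := congr_fun hw k
      simp only [Pi.zero_apply, hrC] at this
      exact_mod_cast this.symm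
    apply hγ0
    rw [hγdef]
    have : ∑ k, ζ k * rot k = 0 := Finset.sum_eq_zero fun k _ => by rw [hr0 k, mul_zero]
    rw [this]; simp
  · have hneg : (-mg.jacDefl θ V ζ).map ((↑) : ℝ → ℂ) *ᵥ w' = (-(0 : ℂ)) • w' := by
      rw [Matrix.map_neg _ (fun a => Complex.ofReal_neg a), Matrix.neg_mulVec, hJw', neg_smul]
    have h := re_eig_gt_of_numRange_shift hS hH hw'0 hneg
    simp at h
    linarith

end DroopMicrogrid

end Summit.Ventures.GridStability.Models

end
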